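import Mathlib
import HarnessLib
import Literature.MathematicalPhysics.QuantumLattice.TorusBandIntegratedDensity

/-!
# Crux `WcbcsBcsConstruction` (stmt-HubbardSuperconductivity-2010), line `ladder-scale-certified-chain`:
# stub (D1b), part 1 — staircase bounds for the integrated density of states of the square-lattice band

Generic input of stub (D1b) `stub_freeLevelCountsWindow` (free level counts at the two ends of the density
window). By the Weyl law of the tree (`TorusBandWeylLaw.tendsto_torusLevelCount_div_sq`) the level counts
`#{k ∈ (ℤ/Lℤ)² : ε_L(k) ≤ E}/L²` converge to the integrated density of states
`N(E) = vol {v ∈ [0,1)² | -2(cos 2πv₀ + cos 2πv₁) ≤ E}`, so (D1b) reduces to two CERTIFIED bounds on `N`.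
This file PROVES the two STAIRCASE bounds for `N(-2m)` on the uniform partition of `[0,1)` into rows
`[j/N, (j+1)/N]` (registered sub-goals of the crux item):

* `volume_real_sublevelCell_le_stairs` — if on every row `cos (2πa_j) + cos (2πŷ_j) ≤ m` at the folded row
  end `ŷ_j = min(j, N-1-j)/N` nearest to the band maximum, the cell `{cos 2πv₀ + cos 2πv₁ ≥ m}` is covered by
  the boxes `([0,a_j] ∪ [1-a_j,1]) × row_j` (strict monotonicity of `cos (2π·)` on `(a, 1-a)`,
  `cos_two_pi_mul_lt_of_mem`), whence `N(-2m) ≤ Σ_j 2a_j/N`;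
* `stairs_le_volume_real_sublevelCell` — dually, if `m ≤ cos (2πb_j) + cos (2πy̌_j)` at the row end `y̌_j`
  nearest to the band minimum (or `b_j = 0`), the complement of the cell in the unit cell is covered by the
  boxes `[b_j, 1-b_j] × row_j`, whence `N(-2m) ≥ 1 - Σ_j (1-2b_j)/N`.

Volumes of coordinate boxes are products (`volume_box`, `Measure.pi_pi`); only `measure_mono`,
`measure_biUnion_finset_le` and `volume_unitCell = 1` are used (no disjointness). Part 2
(`…FreeLevelCountsWindow.lean`) feeds in certified cosine values and two tables of 60 rows checked by
`decide`, and the Weyl law. References: Riemann sums / lattice-point counting for Jordan domains (folklore);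
band convention Benfatto–Giuliani–Mastropietro, AHP 7 (2006) 809, eq. (1.4).
-/

noncomputable section

-- the tree's namespace `Summit.<Summit>.<Problem>.Theorems` repeats the summit name by design (D-0017)
set_option linter.dupNamespace false

namespace Summit.HubbardSuperconductivity.HubbardSuperconductivity.Theorems

open MeasureTheory Finset
open Literature.MathematicalPhysics.QuantumLattice

/-! ### Cosine comparisons on the unit period -/

/-- `cos (2π(1 - x)) = cos (2πx)`. [folklore] -/
theorem cos_two_pi_mul_one_sub (x : ℝ) :
    Real.cos (2 * Real.pi * (1 - x)) = Real.cos (2 * Real.pi * x) := by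
  rw [mul_sub, mul_one, Real.cos_two_pi_sub]

/-- On `[s, 1 - s]` (`0 ≤ s`) the function `cos (2π·)` is at most its value at `s`. [folklore] -/
theorem cos_two_pi_mul_le_of_mem {s y : ℝ} (hs : 0 ≤ s) (hsy : s ≤ y) (hy : y ≤ 1 - s) :
    Real.cos (2 * Real.pi * y) ≤ Real.cos (2 * Real.pi * s) := by
  have hπ := Real.pi_pos
  rcases le_or_gt y (1 / 2) with h | h
  · exact Real.cos_le_cos_of_nonneg_of_le_pi (by positivity) (by nlinarith) (by nlinarith)
  · rw [← cos_two_pi_mul_one_sub y]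
    exact Real.cos_le_cos_of_nonneg_of_le_pi (by positivity) (by nlinarith) (by nlinarith)

/-- On `(a, 1 - a)` (`0 ≤ a`) the function `cos (2π·)` is below its value at `a`. [folklore] -/
theorem cos_two_pi_mul_lt_of_mem {a x : ℝ} (ha : 0 ≤ a) (hax : a < x) (hx : x < 1 - a) :
    Real.cos (2 * Real.pi * x) < Real.cos (2 * Real.pi * a) := by
  have hπ := Real.pi_pos
  rcases le_or_gt x (1 / 2) with h | h
  · exact Real.cos_lt_cos_of_nonneg_of_le_pi (by positivity) (by nlinarith) (by nlinarith)
  · rw [← cos_two_pi_mul_one_sub x]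
    exact Real.cos_lt_cos_of_nonneg_of_le_pi (by positivity) (by nlinarith) (by nlinarith)

/-- Off `(t, 1 - t)` (`t ≤ 1/2`) the function `cos (2π·)` on `[0, 1]` is at least its value at `t`.
[folklore] -/
theorem le_cos_two_pi_mul_of_not_mem {t y : ℝ} (ht : t ≤ 1 / 2) (hy0 : 0 ≤ y) (hy1 : y ≤ 1)
    (h : y ≤ t ∨ 1 - t ≤ y) : Real.cos (2 * Real.pi * t) ≤ Real.cos (2 * Real.pi * y) := by
  have hπ := Real.pi_pos
  rcases h with h | h
  · exact Real.cos_le_cos_of_nonneg_of_le_pi (by positivity) (by nlinarith) (by nlinarith)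
  · rw [← cos_two_pi_mul_one_sub y]
    exact Real.cos_le_cos_of_nonneg_of_le_pi (by positivity) (by nlinarith) (by nlinarith)

/-! ### Rows and boxes of the unit cell -/

/-- The volume of a coordinate box `{v | v 0 ∈ X, v 1 ∈ Y}` of `ℝ²`. [folklore] -/
theorem volume_box (X Y : Set ℝ) :
    volume {v : Fin 2 → ℝ | v 0 ∈ X ∧ v 1 ∈ Y} = volume X * volume Y := by
  have h : {v : Fin 2 → ℝ | v 0 ∈ X ∧ v 1 ∈ Y} = Set.univ.pi ![X, Y] := by
    ext v; simp [Fin.forall_fin_two]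
  rw [h, volume_pi, Measure.pi_pi, Fin.prod_univ_two]
  simp

/-- The row `[j/N, (j+1)/N]`, `j = ⌊yN⌋ < N`, of a point `y ∈ [0, 1)`. [folklore] -/
theorem row_index {N : ℕ} (hN : 0 < N) {y : ℝ} (hy0 : 0 ≤ y) (hy1 : y < 1) :
    ⌊y * N⌋₊ < N ∧ ((⌊y * N⌋₊ : ℕ) : ℝ) / N ≤ y ∧ y ≤ (((⌊y * N⌋₊ : ℕ) : ℝ) + 1) / N := by
  have hNr : (0 : ℝ) < N := by exact_mod_cast hN
  have hyN : 0 ≤ y * N := by positivity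
  refine ⟨?_, ?_, ?_⟩
  · rw [Nat.floor_lt hyN]
    calc y * N < 1 * N := by gcongr
      _ = N := one_mul _
  · rw [div_le_iff₀ hNr]; exact Nat.floor_le hyN
  · rw [le_div_iff₀ hNr]; exact (Nat.lt_floor_add_one _).le

/-! ### The two staircase bounds -/

/-- **Circumscribed staircase.** If on every row `j < N` of the uniform partition of `[0,1)`
`cos (2πa_j) + cos (2πŷ_j) ≤ m` with `a_j ≥ 0` and `ŷ_j = min(j, N-1-j)/N` (the folded row end nearest to
the band maximum), then `vol {v ∈ [0,1)² | -2(cos 2πv₀ + cos 2πv₁) ≤ -2m} ≤ Σ_{j<N} 2a_j/N`: the cell is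
covered by the boxes `([0,a_j] ∪ [1-a_j,1]) × [j/N,(j+1)/N]`. [folklore] -/
theorem volume_real_sublevelCell_le_stairs :
    ∀ {N : ℕ}, 0 < N → ∀ {m : ℝ} (a : ℕ → ℝ), (∀ j < N, 0 ≤ a j) →
      (∀ j < N, Real.cos (2 * Real.pi * a j) +
        Real.cos (2 * Real.pi * (((min j (N - 1 - j) : ℕ) : ℝ) / N)) ≤ m) →
      MeasureTheory.volume.real {v : Fin 2 → ℝ | (∀ i, v i ∈ Set.Ico (0 : ℝ) 1) ∧
          -2 * ∑ i : Fin 2, Real.cos (2 * Real.pi * v i) ≤ -2 * m} ≤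
        ∑ j ∈ Finset.range N, 2 * a j / N := by
  intro N hN m a ha0 hrow
  have hNr : (0 : ℝ) < N := by exact_mod_cast hN
  set S := {v : Fin 2 → ℝ | (∀ i, v i ∈ Set.Ico (0 : ℝ) 1) ∧
        -2 * ∑ i : Fin 2, Real.cos (2 * Real.pi * v i) ≤ -2 * m} with hS
  set B : ℕ → Set (Fin 2 → ℝ) := fun j => {v | v 0 ∈ Set.Icc 0 (a j) ∪ Set.Icc (1 - a j) 1 ∧
      v 1 ∈ Set.Icc ((j : ℝ) / N) (((j : ℝ) + 1) / N)} with hB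
  have hcover : S ⊆ ⋃ j ∈ range N, B j := by
    intro v hv
    obtain ⟨hbox, hband⟩ := hv
    rw [Fin.sum_univ_two] at hband
    obtain ⟨hj, hlo, hhi⟩ := row_index hN (hbox 1).1 (hbox 1).2
    set j := ⌊v 1 * N⌋₊ with hjdef
    refine Set.mem_iUnion₂.2 ⟨j, Finset.mem_range.2 hj, ?_, hlo, hhi⟩
    by_contra hx
    simp only [Set.mem_union, Set.mem_Icc, not_or, not_and, not_le] at hx
    have hx1 : a j < v 0 := hx.1 (hbox 0).1
    have hx2 : v 0 < 1 - a j := by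
      by_contra h'
      exact absurd (hbox 0).2.le (not_le.2 (hx.2 (not_lt.1 h')))
    have hc0 := cos_two_pi_mul_lt_of_mem (ha0 j hj) hx1 hx2
    have hi1 : ((min j (N - 1 - j) : ℕ) : ℝ) ≤ j := by exact_mod_cast Nat.min_le_left _ _
    have hi2 : (j : ℝ) + 1 + ((min j (N - 1 - j) : ℕ) : ℝ) ≤ N := by
      have : j + 1 + min j (N - 1 - j) ≤ N := by have := Nat.min_le_right j (N - 1 - j); omega
      exact_mod_cast this
    have hc1 : Real.cos (2 * Real.pi * v 1) ≤
        Real.cos (2 * Real.pi * (((min j (N - 1 - j) : ℕ) : ℝ) / N)) := by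
      refine cos_two_pi_mul_le_of_mem (by positivity) ?_ (hhi.trans ?_)
      · exact le_trans (div_le_div_of_nonneg_right hi1 hNr.le) hlo
      · rw [le_sub_iff_add_le, ← add_div, div_le_one hNr]
        exact hi2
    have := hrow j hj
    linarith
  have hvol : volume S ≤ ENNReal.ofReal (∑ j ∈ range N, 2 * a j / N) := by
    calc volume S ≤ volume (⋃ j ∈ range N, B j) := measure_mono hcover
      _ ≤ ∑ j ∈ range N, volume (B j) := measure_biUnion_finset_le _ _
      _ ≤ ∑ j ∈ range N, ENNReal.ofReal (2 * a j / N) := Finset.sum_le_sum fun j hj => ?_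
      _ = ENNReal.ofReal (∑ j ∈ range N, 2 * a j / N) := by
        rw [ENNReal.ofReal_sum_of_nonneg fun j hj => ?_]
        exact div_nonneg (by linarith [ha0 j (Finset.mem_range.1 hj)]) hNr.le
    have ha := ha0 j (Finset.mem_range.1 hj)
    rw [hB, volume_box]
    calc volume (Set.Icc 0 (a j) ∪ Set.Icc (1 - a j) 1) *
          volume (Set.Icc ((j : ℝ) / N) (((j : ℝ) + 1) / N))
        ≤ (ENNReal.ofReal (a j) + ENNReal.ofReal (a j)) * ENNReal.ofReal (1 / N) := by
          refine mul_le_mul' ((measure_union_le _ _).trans ?_) ?_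
          · rw [Real.volume_Icc, Real.volume_Icc]
            exact add_le_add (by simp) (by simp)
          · rw [Real.volume_Icc]
            exact le_of_eq (by congr 1; field_simp; ring)
      _ = ENNReal.ofReal (2 * a j / N) := by
          rw [← ENNReal.ofReal_add ha ha, ← ENNReal.ofReal_mul (by linarith)]
          congr 1; field_simp; ring
  rw [measureReal_def]
  refine ENNReal.toReal_le_of_le_ofReal (Finset.sum_nonneg fun j hj => ?_) hvol
  exact div_nonneg (by linarith [ha0 j (Finset.mem_range.1 hj)]) hNr.le

/-- **Inscribed staircase (via the complement).** If on every row `j < 2K` of the uniform partition of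
`[0,1)` either `b_j = 0` or `m ≤ cos (2πb_j) + cos (2πy̌_j)`, with `b_j ≤ 1/2` and
`y̌_j = min(j+1, 2K-j)/(2K)` (the folded row end nearest to the band minimum), then
`1 - Σ_{j<2K} (1-2b_j)/(2K) ≤ vol {v ∈ [0,1)² | -2(cos 2πv₀ + cos 2πv₁) ≤ -2m}`: the complement of the cell
in the unit cell is covered by the boxes `[b_j, 1-b_j] × [j/(2K), (j+1)/(2K)]`. [folklore] -/
theorem stairs_le_volume_real_sublevelCell :
    ∀ {K : ℕ}, 0 < K → ∀ {m : ℝ} (b : ℕ → ℝ), (∀ j < 2 * K, b j ≤ 1 / 2) →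
      (∀ j < 2 * K, b j = 0 ∨ m ≤ Real.cos (2 * Real.pi * b j) +
        Real.cos (2 * Real.pi * (((min (j + 1) (2 * K - j) : ℕ) : ℝ) / (2 * K)))) →
      1 - ∑ j ∈ Finset.range (2 * K), (1 - 2 * b j) / (2 * K) ≤
        MeasureTheory.volume.real {v : Fin 2 → ℝ | (∀ i, v i ∈ Set.Ico (0 : ℝ) 1) ∧
          -2 * ∑ i : Fin 2, Real.cos (2 * Real.pi * v i) ≤ -2 * m} := by
  intro K hK m b hb1 hrow
  have hKr : (0 : ℝ) < K := by exact_mod_cast hK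
  have hN : 0 < 2 * K := by omega
  have h2K : ((2 * K : ℕ) : ℝ) = 2 * K := by push_cast; ring
  set S := {v : Fin 2 → ℝ | (∀ i, v i ∈ Set.Ico (0 : ℝ) 1) ∧
        -2 * ∑ i : Fin 2, Real.cos (2 * Real.pi * v i) ≤ -2 * m} with hS
  set B : ℕ → Set (Fin 2 → ℝ) := fun j => {v | v 0 ∈ Set.Icc (b j) (1 - b j) ∧
      v 1 ∈ Set.Icc ((j : ℝ) / ((2 * K : ℕ) : ℝ)) (((j : ℝ) + 1) / ((2 * K : ℕ) : ℝ))} with hB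
  have hcover : {v : Fin 2 → ℝ | ∀ i, v i ∈ Set.Ico (0 : ℝ) 1} ⊆ S ∪ ⋃ j ∈ range (2 * K), B j := by
    intro v hbox
    by_cases hvS : v ∈ S
    · exact Or.inl hvS
    refine Or.inr ?_
    have hband : Real.cos (2 * Real.pi * v 0) + Real.cos (2 * Real.pi * v 1) < m := by
      simp only [hS, Set.mem_setOf_eq, not_and, not_le, Fin.sum_univ_two] at hvS
      have := hvS hbox
      linarith
    obtain ⟨hj, hlo, hhi⟩ := row_index hN (hbox 1).1 (hbox 1).2
    set j := ⌊v 1 * ((2 * K : ℕ) : ℝ)⌋₊ with hjdef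
    refine Set.mem_iUnion₂.2 ⟨j, Finset.mem_range.2 hj, ?_, hlo, hhi⟩
    rcases hrow j hj with h0 | hle
    · rw [h0, sub_zero]; exact ⟨(hbox 0).1, (hbox 0).2.le⟩
    have hbj1 := hb1 j hj
    rw [h2K] at hlo hhi
    -- the second coordinate: `cos (2π y̌_j) ≤ cos (2π v₁)`
    have hiK : ((min (j + 1) (2 * K - j) : ℕ) : ℝ) ≤ K := by
      have : min (j + 1) (2 * K - j) ≤ K := by omega
      exact_mod_cast this
    have hc1 : Real.cos (2 * Real.pi * (((min (j + 1) (2 * K - j) : ℕ) : ℝ) / (2 * K))) ≤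
        Real.cos (2 * Real.pi * v 1) := by
      refine le_cos_two_pi_mul_of_not_mem ?_ (hbox 1).1 (hbox 1).2.le ?_
      · rw [div_le_iff₀ (by positivity)]; linarith
      · rcases min_choice (j + 1) (2 * K - j) with h | h <;> rw [h]
        · left; exact_mod_cast hhi
        · right
          rw [Nat.cast_sub (by omega)]
          have e : 1 - (((2 * K : ℕ) : ℝ) - j) / (2 * K) = j / (2 * K) := by
            rw [h2K]; field_simp; ring
          rw [e]
          exact hlo
    by_contra hx
    simp only [Set.mem_Icc, not_and_or, not_le] at hx
    have hc0 : Real.cos (2 * Real.pi * b j) < Real.cos (2 * Real.pi * v 0) := by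
      rcases hx with hx | hx
      · exact cos_two_pi_mul_lt_of_mem (hbox 0).1 hx (by linarith)
      · rw [← cos_two_pi_mul_one_sub (v 0)]
        exact cos_two_pi_mul_lt_of_mem (by linarith [(hbox 0).2]) (by linarith) (by linarith)
    linarith
  -- volumes
  have hvolB : ∀ j ∈ range (2 * K), volume (B j) ≤ ENNReal.ofReal ((1 - 2 * b j) / (2 * K)) := by
    intro j hj
    have hb := hb1 j (Finset.mem_range.1 hj)
    rw [hB, volume_box, Real.volume_Icc, Real.volume_Icc, ← ENNReal.ofReal_mul (by linarith)]
    refine le_of_eq ?_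
    congr 1
    push_cast
    field_simp
    ring
  have h1 : (1 : ENNReal) ≤
      volume S + ENNReal.ofReal (∑ j ∈ range (2 * K), (1 - 2 * b j) / (2 * K)) := by
    rw [← volume_unitCell]
    refine (measure_mono hcover).trans ((measure_union_le _ _).trans ?_)
    refine add_le_add le_rfl ((measure_biUnion_finset_le _ _).trans ?_)
    rw [ENNReal.ofReal_sum_of_nonneg fun j hj => ?_]
    · exact Finset.sum_le_sum hvolB
    · exact div_nonneg (by linarith [hb1 j (Finset.mem_range.1 hj)]) (by positivity)
  have hsum0 : 0 ≤ ∑ j ∈ range (2 * K), (1 - 2 * b j) / (2 * K) :=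
    Finset.sum_nonneg fun j hj => div_nonneg (by linarith [hb1 j (Finset.mem_range.1 hj)])
      (by positivity)
  rw [measureReal_def, ← ENNReal.ofReal_le_iff_le_toReal (volume_sublevelCell_ne_top _),
    ENNReal.ofReal_sub _ hsum0, ENNReal.ofReal_one]
  exact tsub_le_iff_right.2 h1

end Summit.HubbardSuperconductivity.HubbardSuperconductivity.Theorems

end
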